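import Summits.KontsevichZagierPeriods.KontsevichZagierPeriods.Theorems.GrothendieckLemniscaticSectorKernel

/-!
# `Lines/singular-modulus-two_special.lean` — F3 witness for the G4 rung `SingularModulusTwoSectorKernel`
(crux item stmt-KontsevichZagierPeriods-18976; planner-fwd-ladder-KontsevichZagierPeriods-53-0)

The graded family `ModulusSectorKernel m` of `Lines/singular-modulus-two.lean` (copied VERBATIM below into the
namespace `…SingularModulusTwo.Special` so that this file elaborates on its own, without the line module being
built) specialises at the floor parameter `m = 1/2` to the PROVED floor
`Summit.KontsevichZagierPeriods.KontsevichZagierPeriods.Theses.Grothendieck.LemniscaticSectorKernel`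
(stmt-KontsevichZagierPeriods-8598, closed by
`Summit.KontsevichZagierPeriods.Grothendieck.SectorComplementRingJoin.lemniscaticSectorKernel_proof` @ a1c7a8d3d820):
the only difference is the spelling `1 − (1/2)·t²` vs `1 − t²/2`, removed by `ring` under the binders.
The same theorem with the same constant is `SingularModulusTwo.modulusSectorKernel_half` in the line file.
-/

noncomputable section

open Literature.NumberTheory.Transcendental

namespace Summit.KontsevichZagierPeriods.KontsevichZagierPeriods.Cruxes.XMapKernelOfCells.SingularModulusTwo.Special

/-- Verbatim copy of `SingularModulusTwo.ModulusSectorKernel` (the graded family; parameter `m = k²`). -/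
def ModulusSectorKernel (m : ℝ) : Prop :=
  ∀ (ι : Type) [Fintype ι] (z : ι → ℤ) (a b c : ι → ℕ)
    (r : ∀ i, KZ.IntegralRep ((a i + b i) + c i)),
    (∀ i, (r i).domain = {x | ∀ j : Fin (a i + b i), x (Fin.castAdd (c i) j) ∈ Set.Ioo (0:ℝ) 1}) →
    (∀ i, Set.EqOn (r i).integrand (fun x =>
        (∏ j : Fin (a i), (1 / Real.sqrt ((1 - x (Fin.castAdd (c i) (Fin.castAdd (b i) j)) ^ 2) *
            (1 - m * x (Fin.castAdd (c i) (Fin.castAdd (b i) j)) ^ 2)))) *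
        (∏ j : Fin (b i), (Real.sqrt (1 - m * x (Fin.castAdd (c i) (Fin.natAdd (a i) j)) ^ 2) /
            Real.sqrt (1 - x (Fin.castAdd (c i) (Fin.natAdd (a i) j)) ^ 2))) *
        ∏ j : Fin (c i), (1 / (1 + x (Fin.natAdd (a i + b i) j) ^ 2))) (r i).domain) →
    KZ.eval (∑ i, z i • KZ.of (r i)) = 0 →
    (∑ i, z i • KZ.of (r i)) ∈ KZ.relations

/-- F3 (special case = the floor): `Rung (1/2)` from the floor decl and nothing else. -/
example : ModulusSectorKernel (1 / 2) := by
  intro ι _ z a b c r hd hi he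
  have h : ∀ y : ℝ, 1 - (1 / 2 : ℝ) * y ^ 2 = 1 - y ^ 2 / 2 := fun y => by ring
  refine Summit.KontsevichZagierPeriods.Grothendieck.SectorComplementRingJoin.lemniscaticSectorKernel_proof
    ι z a b c r hd (fun i => ?_) he
  simpa only [h] using hi i

/-- Conversely the floor is the family at `1/2` (so the identification is exact, not a weakening). -/
example (h12 : ModulusSectorKernel (1 / 2)) :
    Summit.KontsevichZagierPeriods.KontsevichZagierPeriods.Theses.Grothendieck.LemniscaticSectorKernel := by
  intro ι _ z a b c r hd hi he
  have h : ∀ y : ℝ, 1 - y ^ 2 / 2 = 1 - (1 / 2 : ℝ) * y ^ 2 := fun y => by ring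
  refine h12 ι z a b c r hd (fun i => ?_) he
  simpa only [h] using hi i

end Summit.KontsevichZagierPeriods.KontsevichZagierPeriods.Cruxes.XMapKernelOfCells.SingularModulusTwo.Special
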